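import Mathlib
import Summits.MatrixMultiplication.MatrixMultiplication.Theses.LevelGradedCohnUmans

/-!
# `SnLevelDesigns` (stmt-MatrixMultiplication-7613), line `garnir-annihilator`:
# J2 `stub_uniformJuntaWall` — a uniform (target-independent) junta frame caps `|X|·|Z|` at `n ^ k`

Crux `Summit.MatrixMultiplication.MatrixMultiplication.Theses.LevelGradedCohnUmans.SnLevelDesigns`;
skeleton `Cruxes/SnLevelDesigns/Lines/garnir_annihilator.lean` (lead reshape 3, registered stub J2);
this file proves the registered stub `stub_uniformJuntaWall` verbatim (name + signature, tree-only
vocabulary) and lands `--supports stmt-MatrixMultiplication-7613`.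

In the junta sub-certificate of the line a target `t = x₀⁻¹ z₀` (`x₀ ∈ X`, `z₀ ∈ Z`) is told
apart from its garbage by the restriction `t ∘ ι` to a frame `ι : Fin k → Fin n` chosen PER
TARGET. This stub records why the frame must float with the target: if ONE frame `ι` serves all
targets simultaneously (even only against the `y = y'` garbage, i.e. against the other targets
`x⁻¹ z`), then the restriction map `(x, z) ↦ (x⁻¹ z) ∘ ι` is injective on `X ×ˢ Z` with values in
the type `Fin k → Fin n` of cardinality `n ^ k`, so `|X| · |Z| ≤ n ^ k` — exponentially below the
wall `D_k(n) ≈ n^{2k} / k!` that a near-wall design needs.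

Proof (Mathlib only): `Finset.card_product`, `Finset.card_le_card_of_injOn` into
`Finset.univ : Finset (Fin k → Fin n)`, `Fintype.card_fun`, `Fintype.card_fin`.
-/

-- the problem path repeats `MatrixMultiplication` (summit = problem), as in every file of this line
set_option linter.dupNamespace false

namespace Summit.MatrixMultiplication.MatrixMultiplication.Theorems.SnLevelDesigns

/-- The restriction map of the uniform junta wall: a pair of permutations `(x, z)` is sent to the
`k`-tuple `(x⁻¹ z) ∘ ι` of values of the target `x⁻¹ z` on the frame `ι : Fin k → Fin n`. -/
theorem ujw_injOn {n k : ℕ} (X Z : Finset (Equiv.Perm (Fin n))) (ι : Fin k → Fin n)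
    (h : ∀ x₀ ∈ X, ∀ z₀ ∈ Z, ∀ x ∈ X, ∀ z ∈ Z, ¬ (x = x₀ ∧ z = z₀) →
      (⇑(x⁻¹ * z)) ∘ ι ≠ (⇑(x₀⁻¹ * z₀)) ∘ ι) :
    Set.InjOn (fun p : Equiv.Perm (Fin n) × Equiv.Perm (Fin n) => (⇑(p.1⁻¹ * p.2)) ∘ ι)
      ↑(X ×ˢ Z) := by
  intro p hp q hq hpq
  obtain ⟨hp1, hp2⟩ := Finset.mem_product.1 (Finset.mem_coe.1 hp)
  obtain ⟨hq1, hq2⟩ := Finset.mem_product.1 (Finset.mem_coe.1 hq)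
  by_contra hne
  have hne' : ¬ (p.1 = q.1 ∧ p.2 = q.2) := fun hh => hne (Prod.ext hh.1 hh.2)
  exact h q.1 hq1 q.2 hq2 p.1 hp1 p.2 hp2 hne' hpq

/-- **`stub_uniformJuntaWall`** (registered stub J2 of crux stmt-MatrixMultiplication-7613, line
`garnir-annihilator`; the uniform junta wall). If a single frame `ι : Fin k → Fin n` separates
every target `x₀⁻¹ z₀` (`x₀ ∈ X`, `z₀ ∈ Z`) from all the other targets `x⁻¹ z`
(`(x, z) ≠ (x₀, z₀)`) by its restriction to `ι`, then `|X| · |Z| ≤ n ^ k`. Proof: the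
restriction map `(x, z) ↦ (x⁻¹ z) ∘ ι` is injective on `X ×ˢ Z` (`ujw_injOn`) with values in
`Fin k → Fin n`, a type of cardinality `n ^ k`; conclude with `Finset.card_product` and
`Finset.card_le_card_of_injOn`. -/
theorem stub_uniformJuntaWall :
    ∀ (n k : ℕ) (X Z : Finset (Equiv.Perm (Fin n))) (ι : Fin k → Fin n),
      (∀ x₀ ∈ X, ∀ z₀ ∈ Z, ∀ x ∈ X, ∀ z ∈ Z, ¬ (x = x₀ ∧ z = z₀) →
        (⇑(x⁻¹ * z)) ∘ ι ≠ (⇑(x₀⁻¹ * z₀)) ∘ ι) →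
      X.card * Z.card ≤ n ^ k := by
  intro n k X Z ι h
  calc X.card * Z.card = (X ×ˢ Z).card := (Finset.card_product X Z).symm
    _ ≤ (Finset.univ : Finset (Fin k → Fin n)).card :=
        Finset.card_le_card_of_injOn
          (fun p : Equiv.Perm (Fin n) × Equiv.Perm (Fin n) => (⇑(p.1⁻¹ * p.2)) ∘ ι)
          (fun p _ => Finset.mem_coe.2 (Finset.mem_univ _)) (ujw_injOn X Z ι h)
    _ = n ^ k := by
        rw [Finset.card_univ, Fintype.card_fun, Fintype.card_fin, Fintype.card_fin]

end Summit.MatrixMultiplication.MatrixMultiplication.Theorems.SnLevelDesigns
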